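import Summits.CriticalPhenomena.PercolationContinuityZ3.Theorems.Transplant.FKConnectivityAllQForestAdjacentTriangle
import HarnessLib

/-!
# The triangle theorem at fibre level in full: a pair of `M` joining the `u₀`-clusters of `v` and `y` suffices

Support file (`--supports stmt-CriticalPhenomena-4575`), FK sub-lane `prim-bschramm-fk-1` (gen 21) of the post-continuity programme;
builds on p205010 (kernel theorem, internal audit signed; external expert review pending).  No definitions, no named facts, no sorries;
standard axioms.

`…ForestAdjacentTriangle` proves the square-free adjacent forest Rayleigh inequality (`AdjForestRayleighNoSqOn`'s inequality,
`e = ov`, `f = oy`) on every fibre `(M, u₀)` whose pair set contains `s(v, y)` itself.  On a fibre the common part `u₀` lies in BOTH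
configurations of every counted pair, i.e. the fibre is the top fibre of the multigraph `(M ∪ u₀)/u₀`; the honest fibre-level form of
"`v ~ y` in the contracted multigraph" is therefore: SOME free pair `g = s(v', y') ∈ M` joins the `u₀`-cluster of `v` to the
`u₀`-cluster of `y`.  The exchange injection of gen 21 goes through verbatim (`g` cannot lie in a forest through `u₀ ∪ {e, f}`; a forest
through `u₀ ∪ {e, f}` minus `f` separates `v'` from `y'`; a forest through `u₀ ∪ {g}` minus `g` cannot join `o` to both `v` and `y`):
* **`adjForestNoSq_fibre_of_triangle_cluster_mem`** (`e, f, g ∈ M`, `o ∉ {v, y}`, `v ≠ y`, `v ~ v'`, `y ~ y'` in `u₀`);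
* **`adjForestNoSq_fibre_of_triangle_cluster`**: the node's inequality on every fibre `(M, u₀)` with such a pair `g ∈ M ∪ u₀`.
[cite: SempleWelsh2008, Conj. 1.1 (p. 2); Thm. 4.2 (p. 11)] [cite: Linusson2011, Prop. 2.6] [cite: Grimmett2006, §1.5 (p. 13)]
-/

noncomputable section

namespace Summit.CriticalPhenomena.PercolationContinuityZ3.Theorems
namespace FK

open MeasureTheory Set Literature.Probability.LatticeModels Literature.Probability.Percolation
open scoped Classical symmDiff

variable {V : Type*} [Fintype V]

section TriangleCluster

variable {M u₀ : BondConfig V} {o v y v' y' : V}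

omit [Fintype V] in
/-- On the fibre `(M, u₀)` the common part lies in the configuration and in its partner. [folklore] -/
theorem subset_symmDiff_of_fibre {ω : BondConfig V} (hω : ω \ M = u₀) : u₀ ⊆ ω ∆ M := by
  rw [← symmDiff_sdiff_self_right ω M] at hω; exact subset_of_fibre hω

omit [Fintype V] in
/-- A free pinned pair whose ends are already joined by the common part cannot lie in a forest of the fibre.
[cite: Grimmett2006, §1.5 (p. 13)] -/
theorem not_isForestCfg_of_mem_of_reachable {ω : BondConfig V} {a b : V} (hab : s(a, b) ∈ ω) (habu : s(a, b) ∉ u₀) (hu : u₀ ⊆ ω)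
    (hr : (openGraph u₀).Reachable a b) : ¬ IsForestCfg ω := by
  intro hF
  by_cases hd : a = b
  · exact hF.1 _ hab (Sym2.mk_isDiag_iff.2 hd)
  · have hsub : u₀ ⊆ ω \ {s(a, b)} := fun x hx => ⟨hu hx, fun h => habu (mem_singleton_iff.1 h ▸ hx)⟩
    have hback : insert s(a, b) (ω \ {s(a, b)}) = ω := by rw [insert_sdiff_singleton, insert_eq_of_mem hab]
    have hF' : IsForestCfg (insert s(a, b) (ω \ {s(a, b)})) := by rwa [hback]
    exact ((isForestCfg_insert_iff hd fun h => h.2 rfl).1 hF').2 (hr.mono (openGraph_mono hsub))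

/-- **The triangle theorem through the `u₀`-clusters, main case**: `e = ov, f = oy, g = v'y' ∈ M`, `o ∉ {v, y}`, `v ≠ y`,
`v ~ v'` and `y ~ y'` in `openGraph u₀`.  [cite: SempleWelsh2008, Conj. 1.1 (p. 2)] [cite: Linusson2011, Prop. 2.6]
[cite: Grimmett2006, §1.5 (p. 13)] -/
theorem adjForestNoSq_fibre_of_triangle_cluster_mem (hd : Disjoint u₀ M) (hov : o ≠ v) (hoy : o ≠ y) (hvy : v ≠ y)
    (heM : s(o, v) ∈ M) (hfM : s(o, y) ∈ M) (hgM : s(v', y') ∈ M)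
    (hv : (openGraph u₀).Reachable v v') (hy : (openGraph u₀).Reachable y y') :
    fibreCount M u₀ (forestEv V ∩ {ω | s(o, v) ∈ ω ∧ s(o, y) ∈ ω}) (forestEv V) ≤
      fibreCount M u₀ (forestEv V ∩ {ω | s(o, v) ∈ ω}) (forestEv V ∩ {ω | s(o, y) ∈ ω}) := by
  have hef : s(o, v) ≠ s(o, y) := fun h' => hvy (Sym2.congr_right.1 h')
  have hdis : ∀ {g : Sym2 V}, g ∈ M → g ∉ u₀ := fun hg hgu => Set.disjoint_left.1 hd hgu hg
  -- facts valid for every bad pair of the fibre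
  have key : ∀ ω : BondConfig V, ω \ M = u₀ → IsForestCfg ω → s(o, v) ∈ ω → s(o, y) ∈ ω → IsForestCfg (ω ∆ M) →
      v' ≠ y' ∧ s(v', y') ∉ ω ∧ ¬ (openGraph (ω \ {s(o, y)})).Reachable v' y' ∧ ¬ (openGraph (ω \ {s(o, v)})).Reachable y' v' ∧
        ((openGraph ((ω ∆ M) \ {s(v', y')})).Reachable o v → (openGraph ((ω ∆ M) \ {s(v', y')})).Reachable o y → False) := by
    intro ω hω hF he hf hB
    have hu : u₀ ⊆ ω := subset_of_fibre hω
    have huB : u₀ ⊆ ω ∆ M := subset_symmDiff_of_fibre hω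
    -- removing `f`: `v' ~ v ~ o`, `y ~ y'`, `o ≁ y`
    have huf : u₀ ⊆ ω \ {s(o, y)} := fun x hx => ⟨hu hx, fun h => hdis hfM (mem_singleton_iff.1 h ▸ hx)⟩
    have hue : u₀ ⊆ ω \ {s(o, v)} := fun x hx => ⟨hu hx, fun h => hdis heM (mem_singleton_iff.1 h ▸ hx)⟩
    have hsepf : ¬ (openGraph (ω \ {s(o, y)})).Reachable v' y' := fun h =>
      not_reachable_sdiff_of_two_mem hov hoy hvy hF he hf
        (((hv.mono (openGraph_mono huf)).trans h).trans (hy.mono (openGraph_mono huf)).symm)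
    have hsepe : ¬ (openGraph (ω \ {s(o, v)})).Reachable y' v' := by
      intro h
      exact not_reachable_sdiff_of_two_mem hoy hov hvy.symm hF hf he
        (((hy.mono (openGraph_mono hue)).trans h).trans (hv.mono (openGraph_mono hue)).symm)
    have hne : v' ≠ y' := by
      rintro rfl; exact hsepf SimpleGraph.Reachable.rfl
    -- `g ≠ f`: `s(v',y') = s(o,y)` gives `{v',y'} = {o,y}`; either way `u₀` joins `o` to `v` or to `y` inside the forest `ω`
    have hgf : s(v', y') ≠ s(o, y) := by
      intro h
      rcases Sym2.eq_iff.1 h with ⟨h1, h2⟩ | ⟨h1, h2⟩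
      · subst h1; subst h2
        exact not_isForestCfg_of_mem_of_reachable he (hdis heM) hu hv.symm hF
      · subst h1; subst h2
        exact not_isForestCfg_of_mem_of_reachable hf (hdis hfM) hu hy.symm hF
    have hgω : s(v', y') ∉ ω := by
      intro hg
      have hg' : s(v', y') ∈ ω \ {s(o, y)} := ⟨hg, fun h => hgf (mem_singleton_iff.1 h)⟩
      exact hsepf ((openGraph_adj _ _ _).2 ⟨hg', hne⟩).reachable
    refine ⟨hne, hgω, hsepf, hsepe, fun h₁ h₂ => ?_⟩
    have hgB : s(v', y') ∈ ω ∆ M := Set.mem_symmDiff.2 (Or.inr ⟨hgM, hgω⟩)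
    have hug : u₀ ⊆ (ω ∆ M) \ {s(v', y')} := fun x hx => ⟨huB hx, fun h => hdis hgM (mem_singleton_iff.1 h ▸ hx)⟩
    exact not_reachable_both_sdiff hne hB hgB (h₁.trans (hv.mono (openGraph_mono hug))) (h₂.trans (hy.mono (openGraph_mono hug)))
  -- no free pair can be a loop of a counted partner: `v' = y'` empties the left side
  by_cases hne : v' = y'
  · rw [fibreCount_eq_zero_of_forall _ _ _ _ fun ω hω hA hB => (key ω hω hA.1 hA.2.1 hA.2.2 hB).1 hne]
    exact Nat.zero_le _
  -- the case split, exactly as in the triangle theorem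
  set C : Set (BondConfig V) := {ω | ¬ (openGraph ((ω ∆ M) \ {s(v', y')})).Reachable o y} with hC
  set P : Set (BondConfig V) := forestEv V ∩ {ω | s(o, v) ∈ ω ∧ s(o, y) ∈ ω} with hP
  have hsplit : P = (P ∩ C) ∪ (P ∩ Cᶜ) := by rw [← inter_union_distrib_left, union_compl_self, inter_univ]
  have hdisj : Disjoint (P ∩ C) (P ∩ Cᶜ) := Set.disjoint_left.2 fun ω h₁ h₂ => h₂.2 h₁.2
  rw [hsplit, fibreCount_split_left _ _ _ hdisj]
  have h1 : fibreCount M u₀ (P ∩ C) (forestEv V) ≤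
      fibreCount M u₀ (forestEv V ∩ {ω | s(o, v) ∈ ω} ∩ {ω | s(v', y') ∈ ω}) (forestEv V ∩ {ω | s(o, y) ∈ ω}) := by
    refine le_trans (fibreCount_mono_fibre M u₀ fun ω hω hA hB => ⟨?_, hB⟩)
      (fibreCount_exchange_le (a := s(o, y)) (b := s(o, v)) (p := y) rfl hoy hne hfM hgM hef.symm)
    obtain ⟨⟨hF, he, hf⟩, hc⟩ := hA
    obtain ⟨-, hgω, hsepf, -, -⟩ := key ω hω hF he hf hB
    exact ⟨⟨hF, hf, he⟩, hgω, hsepf, hc⟩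
  have h2 : fibreCount M u₀ (P ∩ Cᶜ) (forestEv V) ≤
      fibreCount M u₀ (forestEv V ∩ {ω | s(o, v) ∈ ω} ∩ {ω | s(v', y') ∉ ω}) (forestEv V ∩ {ω | s(o, y) ∈ ω}) := by
    have step : fibreCount M u₀ (P ∩ Cᶜ) (forestEv V) ≤
        fibreCount M u₀ (forestEv V ∩ {ω | s(o, y) ∈ ω} ∩ {ω | s(v', y') ∈ ω}) (forestEv V ∩ {ω | s(o, v) ∈ ω}) := by
      refine le_trans (fibreCount_mono_fibre M u₀ fun ω hω hA hB => ⟨?_, hB⟩)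
        (fibreCount_exchange_le (a := s(o, v)) (b := s(o, y)) (p := v) rfl hov hne heM hgM hef)
      obtain ⟨⟨hF, he, hf⟩, hc⟩ := hA
      obtain ⟨-, hgω, -, hsepe, hboth⟩ := key ω hω hF he hf hB
      exact ⟨⟨hF, he, hf⟩, hgω, fun h => hsepe h.symm, fun h => hboth h (not_not.1 hc)⟩
    refine le_trans step ?_
    rw [fibreCount_swap]
    refine fibreCount_mono_fibre M u₀ fun ω _ hA hB => ⟨⟨hA, fun h' => ?_⟩, hB.1⟩
    have hg2 : s(v', y') ∈ ω ∆ M := hB.2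
    rw [Set.mem_symmDiff] at hg2
    rcases hg2 with ⟨-, h''⟩ | ⟨-, h''⟩
    · exact h'' hgM
    · exact h'' h'
  have hsum : fibreCount M u₀ (forestEv V ∩ {ω | s(o, v) ∈ ω} ∩ {ω | s(v', y') ∈ ω}) (forestEv V ∩ {ω | s(o, y) ∈ ω}) +
      fibreCount M u₀ (forestEv V ∩ {ω | s(o, v) ∈ ω} ∩ {ω | s(v', y') ∉ ω}) (forestEv V ∩ {ω | s(o, y) ∈ ω}) =
      fibreCount M u₀ (forestEv V ∩ {ω | s(o, v) ∈ ω}) (forestEv V ∩ {ω | s(o, y) ∈ ω}) := by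
    rw [← fibreCount_split_left _ _ _ (Set.disjoint_left.2 fun ω h₁ h₂ => h₂.2 h₁.2)]
    congr 1
    ext ω
    simp only [mem_union, mem_inter_iff, mem_setOf_eq]
    tauto
  omega

/-- **THE TRIANGLE THEOREM AT FIBRE LEVEL, FULL FORM**: the square-free adjacent forest Rayleigh inequality holds on every fibre
`(M, u₀)` in which some pair `g = s(v', y') ∈ M ∪ u₀` joins the `u₀`-cluster of `v` to the `u₀`-cluster of `y` — i.e. on every fibre
whose contracted multigraph `(M ∪ u₀)/u₀` has `v ~ y`.  (Loops, absent and doubled pinned pairs as in `adjForestNoSq_fibre_of_triangle`;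
`g ∈ u₀` makes every counted configuration contain the cycle `o v ~ v' y' ~ y o`, so the left side vanishes.)
[cite: SempleWelsh2008, Conj. 1.1 (p. 2); Thm. 4.2 (p. 11)] [cite: Linusson2011, Prop. 2.6] [cite: Grimmett2006, §1.5 (p. 13)] -/
theorem adjForestNoSq_fibre_of_triangle_cluster (hd : Disjoint u₀ M) (hvy : v ≠ y)
    (hv : (openGraph u₀).Reachable v v') (hy : (openGraph u₀).Reachable y y') (hg : s(v', y') ∈ M ∨ s(v', y') ∈ u₀) :
    fibreCount M u₀ (forestEv V ∩ {ω | s(o, v) ∈ ω ∧ s(o, y) ∈ ω}) (forestEv V) ≤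
      fibreCount M u₀ (forestEv V ∩ {ω | s(o, v) ∈ ω}) (forestEv V ∩ {ω | s(o, y) ∈ ω}) := by
  by_cases hov : o = v
  · subst hov
    rw [fibreCount_eq_zero_of_forall _ _ _ _ fun ω _ hA _ =>
      not_mem_of_isForestCfg_of_isDiag hA.1 (Sym2.mk_isDiag_iff.2 rfl) hA.2.1]
    exact Nat.zero_le _
  by_cases hoy : o = y
  · subst hoy
    rw [fibreCount_eq_zero_of_forall _ _ _ _ fun ω _ hA _ =>
      not_mem_of_isForestCfg_of_isDiag hA.1 (Sym2.mk_isDiag_iff.2 rfl) hA.2.2]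
    exact Nat.zero_le _
  by_cases he : s(o, v) ∉ M ∧ s(o, v) ∉ u₀
  · rw [fibreCount_eq_zero_of_forall _ _ _ _ fun ω hω hA _ =>
      (mem_union_of_fibre hω hA.2.1).elim he.1 he.2]
    exact Nat.zero_le _
  by_cases hf : s(o, y) ∉ M ∧ s(o, y) ∉ u₀
  · rw [fibreCount_eq_zero_of_forall _ _ _ _ fun ω hω hA _ =>
      (mem_union_of_fibre hω hA.2.2).elim hf.1 hf.2]
    exact Nat.zero_le _
  rw [not_and_or, not_not, not_not] at he hf
  have hdis : ∀ {g : Sym2 V}, g ∈ u₀ → g ∉ M := fun hg' hgM => Set.disjoint_left.1 hd hg' hgM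
  rcases he with heM | heu
  · rcases hf with hfM | hfu
    · rcases hg with hgM | hgu
      · exact adjForestNoSq_fibre_of_triangle_cluster_mem hd hov hoy hvy heM hfM hgM hv hy
      · -- `g ∈ u₀`: then `v ~ y` in `u₀`, and `u₀ ∪ {e, f}` lies in every counted `ω`: the left side vanishes
        have hvy' : (openGraph u₀).Reachable v y := by
          by_cases hne : v' = y'
          · exact hv.trans (hne ▸ hy.symm)
          · exact (hv.trans ((openGraph_adj _ _ _).2 ⟨hgu, hne⟩).reachable).trans hy.symm
        rw [fibreCount_eq_zero_of_forall _ _ _ _ fun ω hω hA _ => ?_]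
        · exact Nat.zero_le _
        · obtain ⟨hF, heω, hfω⟩ := hA
          have hu : u₀ ⊆ ω \ {s(o, y)} :=
            fun x hx => ⟨subset_of_fibre hω hx, fun h => hdis (mem_singleton_iff.1 h ▸ hx) hfM⟩
          exact not_reachable_sdiff_of_two_mem hov hoy hvy hF heω hfω (hvy'.mono (openGraph_mono hu))
    · refine fibreCount_mono_fibre M u₀ fun ω hω hA hB => ?_
      have hfω : s(o, y) ∈ ω := subset_of_fibre hω hfu
      exact ⟨⟨hA.1, hA.2.1⟩, hB, Set.mem_symmDiff.2 (Or.inl ⟨hfω, hdis hfu⟩)⟩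
  · have heM : s(o, v) ∉ M := hdis heu
    refine le_trans (fibreCount_mono_fibre M u₀ (A' := forestEv V ∩ {ω | s(o, y) ∈ ω}) (B' := forestEv V ∩ {ω | s(o, v) ∈ ω})
      fun ω hω hA hB => ?_) (le_of_eq (fibreCount_swap _ _ _ _))
    have heω : s(o, v) ∈ ω := subset_of_fibre hω heu
    exact ⟨⟨hA.1, hA.2.2⟩, hB, Set.mem_symmDiff.2 (Or.inl ⟨heω, heM⟩)⟩

end TriangleCluster

end FK
end Summit.CriticalPhenomena.PercolationContinuityZ3.Theorems

end
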